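import Mathlib
import Summits.Ventures.HodgeRepro2.FaceData
import Summits.Ventures.HodgeRepro2.LiuOscillator
import Summits.Ventures.HodgeRepro2.LiuFace

/-!
# Bridge between p2's adèlic face datum and p1's sign-only face datum (overlap #2 of the bus)

Blind cell `pub-hodge-repro2`, seat p2 (file 14).  The Definition 4.12 sign condition of Liu,
Cambridge J. Math. 9 (2021) p. 47 ll. 5–8, was formalised twice in this prefix: p1's
`IsLiuSignElement Φ e` (`FaceData.lean`, landed first) and p2's `IsMuAdmissibleRep Φ e`
(`LiuOscillator.lean`, landed second).  Per the lead's instruction (STATUS 2026-08-24T21:57:28Z: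
«whichever lands second, please add the bridging iff … and use the first-landed definition from
then on») this file PROVES the two conditions equal and relates the two face data:

* `isMuAdmissibleRep_iff_isLiuSignElement` — the bridging iff (the conditions are the same
  conjunction; `star` on a CM field is Mathlib's `complexConj`);
* `FaceOscillatorData.toFaceData` — p2's adèlic datum (four oscillator triples `(μ_i, ε_{e_i}, χ_i)`,
  `LiuFace.lean`) projects onto p1's sign-only datum `∀ i, VertexDatum τ₀ (T i)` (`FaceData.lean`);
* `FaceOscillatorData.ofFaceData` — conversely p1's sign data together with weight-one conjugate
  symplectic characters `μ_i` of CM type `T_i^{-1}` and characters `χ_i` assemble into p2's datum;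
* `exists_isMuAdmissibleRep'` — the row-L7 existence re-derived from p1's `exists_isLiuSignElement`
  (so that `LiuFace.lean`'s own proof is not needed downstream).

From here on p1's `IsLiuSignElement` is the reference form of the sign condition.
-/

namespace Summit.Ventures.HodgeRepro2.ShimuraData.Liu

open NumberField

variable (K : Type*) [Field K] [NumberField K] [IsCMField K]

/-- `LiuOscillator.lean`'s `IsMuAdmissibleRep Φ e` (Definition 4.12 sign condition for the
representative `e`) IS p1's `IsLiuSignElement Φ e` of `FaceData.lean` (`star e = −e ∧ e ≠ 0 ∧
∀ τ′ ∈ Φ, Im τ′(e) < 0`).  PROVED. -/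
theorem isMuAdmissibleRep_iff_isLiuSignElement (Φ : Set (K →+* ℂ)) (e : K) :
    IsMuAdmissibleRep K Φ e ↔ IsLiuSignElement K Φ e :=
  ⟨fun ⟨⟨h1, h2⟩, h3⟩ => ⟨h1, h2, h3⟩, fun ⟨h1, h2, h3⟩ => ⟨⟨h1, h2⟩, h3⟩⟩

/-- Row L7 of `route/TIER3.md` §4.4 re-derived from p1's `exists_isLiuSignElement`: every CM type
admits a representative `e` with the Definition 4.12 sign condition.  PROVED. -/
theorem exists_isMuAdmissibleRep' {Φ : Set (K →+* ℂ)} (hΦ : IsCMType K Φ) :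
    ∃ e : K, IsMuAdmissibleRep K Φ e :=
  let ⟨e, he⟩ := exists_isLiuSignElement K hΦ
  ⟨e, (isMuAdmissibleRep_iff_isLiuSignElement K Φ e).mpr he⟩

namespace FaceOscillatorData

variable {K} [IsGalois ℚ K] {c : IdeleConjugation K} {χEF : QuadraticCharacter K c}
  {τ₀ : K →+* ℂ} {T : Fin 4 → Set (K →+* ℂ)}

/-- The projection of p2's adèlic face datum onto p1's sign-only face datum (`FaceData.lean`):
forget `μ_i` and `χ_i`, keep `e_i` with its sign condition on `T_i^{-1}`. -/
def toFaceData (D : FaceOscillatorData K c χEF τ₀ T) :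
    Summit.Ventures.HodgeRepro2.FaceOscillatorData K τ₀ T :=
  fun i => ⟨(D.vertex i).e, (isMuAdmissibleRep_iff_isLiuSignElement K _ _).mp (D.admissible i)⟩

/-- The projection keeps the sign elements. -/
@[simp] theorem toFaceData_e (D : FaceOscillatorData K c χEF τ₀ T) (i : Fin 4) :
    (D.toFaceData i).e = (D.vertex i).e := rfl

/-- Conversely, p1's sign data `S` (one `e_i` per vertex with the Definition 4.12 sign condition on
`T_i^{-1}`), together with weight-one conjugate symplectic characters `μ_i` of CM type `T_i^{-1}`
(row L6) and characters `χ_i` of `E¹\(𝔸_E^∞)^1` (row L8), assemble into p2's adèlic datum. -/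
def ofFaceData (hT : IsWeilFace K T) (S : Summit.Ventures.HodgeRepro2.FaceOscillatorData K τ₀ T)
    (μ : Fin 4 → AutomorphicCharacter K)
    (hμ : ∀ i, IsConjugateSymplectic K c χEF (μ i) ∧ IsWeightOne K (inverseType K τ₀ (T i)) (μ i))
    (χ : Fin 4 → OneCharacter K c) : FaceOscillatorData K c χEF τ₀ T where
  face := hT
  vertex := fun i =>
    { μ := μ i
      μ_symplectic := (hμ i).1
      e := (S i).e
      e_mem := ⟨(S i).sign.1, (S i).sign.2.1⟩
      χ := χ i }
  weightOne := fun i => (hμ i).2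
  admissible := fun i => (isMuAdmissibleRep_iff_isLiuSignElement K _ _).mpr (S i).sign

/-- Round trip: projecting the assembled datum returns the sign data. -/
theorem toFaceData_ofFaceData (hT : IsWeilFace K T)
    (S : Summit.Ventures.HodgeRepro2.FaceOscillatorData K τ₀ T)
    (μ : Fin 4 → AutomorphicCharacter K)
    (hμ : ∀ i, IsConjugateSymplectic K c χEF (μ i) ∧ IsWeightOne K (inverseType K τ₀ (T i)) (μ i))
    (χ : Fin 4 → OneCharacter K c) (i : Fin 4) :
    ((ofFaceData hT S μ hμ χ).toFaceData i).e = (S i).e := rfl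

end FaceOscillatorData

end Summit.Ventures.HodgeRepro2.ShimuraData.Liu
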